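import Summits.QuantumFields.YangMills.Theorems.PoincareLipschitzKuhnSphereDistance
import Summits.QuantumFields.YangMills.Theorems.PoincareLipschitzBlowDownRescale
import HarnessLib

/-!
# The blow-down package at unit scale for the Courant `P1` (Freudenthal–Kuhn) interpolant: sup bound, Dirichlet-energy bound,
# `L²` distance-to-the-sphere bound (K2 organ `hImproveCoreFlat`, ORGAN memo §4 brick B3, mesh-side half; LINE 25
# `stub_latticeToContinuumLimit` (Γ1); cell ym3-torus, seat px7 g7)

Helper toward crux `stmt-QuantumFields-19936` (`Summit.QuantumFields.YangMills.Theses.UnitScaleTilt.HistoryTailL`).  Capstone over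
the siblings `…KuhnHat` ∕ `…KuhnInterpolant` ∕ `…KuhnSimplexVolume` ∕ `…KuhnPathSums` ∕ `…KuhnEnergy` ∕ `…KuhnSphereDistance` ∕
`…BlowDownRescale`.  For unit lattice data `u` on `box z (R+1)` (`0 ≤ R`), the interpolant `I` (`hI`) and its blow-down
`J x := I (c + (R + 1∕2) • x)` centred at `c i = z i + 1∕2` (so the open unit cube `{|x i| < 1}` is mapped onto the big box
`{z i − R < X i < z i + R + 1}`):
* `exists_corner_closedSimplex`, ★`norm_interp_le_one_on_bigBox` — every point of the big box lies in a closed Kuhn simplex of its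
  floor cube, whence `‖I X‖ ≤ 1` there;
* ★★★ `blowDown_package` — (i) `‖J x‖ ≤ 1` on the unit cube; (ii) `∫_{|x|<1} ∑_i ‖fderiv ℝ J x (single i 1)‖² ≤ (R + 1∕2)⁻¹ · E(box z (R+1))`;
  (iii) `∫_{|x|<1} (‖J x‖ − 1)² ≤ 3 (R + 1∕2)⁻³ · E(box z (R+1))`, `E(B) = ∑_{w ∈ B} ∑_μ ‖u (w + unitVec μ) − u w‖²` the organ's lattice
  energy.  Under the organ's bound `E ≤ Λ₀·(R+1)` these read: energy `≤ 2Λ₀`, sphere defect `≤ 6Λ₀∕(R + 1∕2)² → 0` — the (Γ1)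
  uniform bounds of the blow-down sequence in LINE 25's letters.  NOT here: the weak-`H¹`∕Rellich extraction of a limit and its
  identification (XL, Mathlib-blocked), the continuum → lattice sampling (w7 g13's B3-b), the pasting (✓`exists_unit_interpolant`).

HONEST: bookkeeping; nothing of `stub_latticeToContinuumLimit`, `hImproveCoreFlat`, K1, `MeanDeviationL`, `BlockLipschitzL`,
`HistoryTailL` or any rung statement is proved; YM₃ on T³ is ladder rung R3 — not d = 4, not infinite volume, not a mass gap, not Clay.
-/

open scoped BigOperators Pointwise
open Literature.MathematicalPhysics.QuantumFieldTheory.Balaban1983to89 B4Eq19LatticeOperators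

noncomputable section

namespace Summit.QuantumFields.YangMills.Theorems.PoincareLipschitzKuhnBlowDown

open MeasureTheory
open Summit.QuantumFields.YangMills.Theorems.PoincareLipschitzKuhnHat
open Summit.QuantumFields.YangMills.Theorems.PoincareLipschitzKuhnInterpolant
open Summit.QuantumFields.YangMills.Theorems.PoincareLipschitzKuhnSimplexVolume
open Summit.QuantumFields.YangMills.Theorems.PoincareLipschitzKuhnPathSums
open Summit.QuantumFields.YangMills.Theorems.PoincareLipschitzKuhnEnergy
open Summit.QuantumFields.YangMills.Theorems.PoincareLipschitzKuhnSphereDistance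
open Summit.QuantumFields.YangMills.Theorems.PoincareLipschitzBlowDownRescale

variable {E : Type*} [NormedAddCommGroup E] [NormedSpace ℝ E]
variable (φ : (Fin 3 → ℝ) → ℝ)

/-! ## §10 The blow-down package: sup bound, energy bound, sphere-distance bound at unit scale -/

/-- A point of the big open box `{z i − R < X i < z i + R + 1}` lies in the CLOSED unit cube of its floor corner `y ∈ box z R`,
inside the closed Kuhn simplex of a sorting permutation. -/
theorem exists_corner_closedSimplex (z : Zd 3) (R : ℤ) {X : EuclideanSpace ℝ (Fin 3)}
    (hX : ∀ i, (z i : ℝ) - R < X i ∧ X i < z i + R + 1) :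
    ∃ (y : Zd 3) (σ : Equiv.Perm (Fin 3)), y ∈ box z R ∧ (y (σ 2) : ℝ) ≤ X (σ 2) ∧
      X (σ 2) - y (σ 2) ≤ X (σ 1) - y (σ 1) ∧ X (σ 1) - y (σ 1) ≤ X (σ 0) - y (σ 0) ∧ X (σ 0) ≤ y (σ 0) + 1 := by
  set y : Zd 3 := fun i => ⌊X i⌋ with hy
  obtain ⟨σ, h1, h2⟩ := exists_perm_antitone (fun i => X i - (y i : ℝ))
  refine ⟨y, σ, ?_, ?_, h1, h2, ?_⟩
  · rw [mem_box]; intro i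
    have hlo : z i - R ≤ ⌊X i⌋ := Int.le_floor.mpr (by push_cast; linarith [(hX i).1])
    have hhi : ⌊X i⌋ < z i + R + 1 := Int.floor_lt.mpr (by push_cast; linarith [(hX i).2])
    exact abs_le.mpr ⟨by simp only [hy]; linarith, by simp only [hy]; linarith⟩
  · exact Int.floor_le _
  · exact (Int.lt_floor_add_one _).le

/-- ★ GLOBAL SUP BOUND: for unit data on `box z (R+1)`, `‖I X‖ ≤ 1` at EVERY point of the big open box. -/
theorem norm_interp_le_one_on_bigBox
    (hφ : ∀ t, φ t = max 0 (1 + min 0 (min (t 0) (min (t 1) (t 2))) - max 0 (max (t 0) (max (t 1) (t 2)))))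
    (S : Finset (Zd 3)) (u : Zd 3 → E) (I : EuclideanSpace ℝ (Fin 3) → E)
    (hI : ∀ x, I x = ∑ w ∈ S, φ (fun i => x i - (w i : ℝ)) • u w) (hu : ∀ w, ‖u w‖ ≤ 1)
    (z : Zd 3) (R : ℤ) (hS : ∀ w ∈ box z (R + 1), w ∈ S) {X : EuclideanSpace ℝ (Fin 3)}
    (hX : ∀ i, (z i : ℝ) - R < X i ∧ X i < z i + R + 1) : ‖I X‖ ≤ 1 := by
  obtain ⟨y, σ, hy, h0, h1, h2, h3⟩ := exists_corner_closedSimplex z R hX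
  have hcorner : ∀ v : Zd 3, (∀ i, v i = 0 ∨ v i = 1) → y + v ∈ S := fun v hv => hS _ (add_mem_box_succ hy hv)
  obtain ⟨hS0, hS1, hS2, hS3⟩ := pathVertices_mem S y hcorner σ
  exact norm_interp_le_one φ hφ S u I hI hu y σ hS0 hS1 hS2 hS3 h0 h1 h2 h3

/-- ★★★ THE BLOW-DOWN PACKAGE AT UNIT SCALE.  For unit lattice data on `box z (R+1)` and the rescaled interpolant
`J x := I (c + R' • x)` with centre `c i = z i + 1∕2` and half-width `R' = R + 1∕2` (so that `|x i| < 1 ↔ X ∈` big box):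
(i) `‖J x‖ ≤ 1` on the open unit cube; (ii) `∫_{|x|<1} ∑_i ‖∂_i J‖² ≤ R'⁻¹ · E(box z (R+1))`;
(iii) `∫_{|x|<1} (‖J x‖ − 1)² = R'⁻³ · ∫_{bigBox} (‖I‖ − 1)² ≤ 3 R'⁻³ · E(box z (R+1))`. -/
theorem blowDown_package
    (hφ : ∀ t, φ t = max 0 (1 + min 0 (min (t 0) (min (t 1) (t 2))) - max 0 (max (t 0) (max (t 1) (t 2)))))
    (S : Finset (Zd 3)) (u : Zd 3 → E) (I : EuclideanSpace ℝ (Fin 3) → E)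
    (hI : ∀ x, I x = ∑ w ∈ S, φ (fun i => x i - (w i : ℝ)) • u w) (hu : ∀ w, ‖u w‖ = 1)
    (z : Zd 3) (R : ℤ) (hR : 0 ≤ R) (hS : ∀ w ∈ box z (R + 1), w ∈ S)
    (c : EuclideanSpace ℝ (Fin 3)) (hc : ∀ i, c i = (z i : ℝ) + 1 / 2)
    (J : EuclideanSpace ℝ (Fin 3) → E) (hJ : ∀ x, J x = I (c + ((R : ℝ) + 1 / 2) • x)) :
    (∀ x : EuclideanSpace ℝ (Fin 3), (∀ i, |x i| < 1) → ‖J x‖ ≤ 1) ∧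
    ∫ x in {x : EuclideanSpace ℝ (Fin 3) | ∀ i, |x i| < 1},
        ∑ i : Fin 3, ‖fderiv ℝ J x (EuclideanSpace.single i (1:ℝ))‖ ^ 2 ≤
      ((R : ℝ) + 1 / 2)⁻¹ * ∑ w ∈ box z (R + 1), ∑ μ : Fin 3, ‖u (w + unitVec μ) - u w‖ ^ 2 ∧
    ∫ x in {x : EuclideanSpace ℝ (Fin 3) | ∀ i, |x i| < 1}, (‖J x‖ - 1) ^ 2 ≤
      3 * (((R : ℝ) + 1 / 2) ^ 3)⁻¹ * ∑ w ∈ box z (R + 1), ∑ μ : Fin 3, ‖u (w + unitVec μ) - u w‖ ^ 2 := by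
  have hR' : 0 < (R : ℝ) + 1 / 2 := by positivity
  have hJeq : J = fun x => I (c + ((R : ℝ) + 1 / 2) • x) := funext hJ
  -- the image box of the unit cube is the big box
  have hbox : {X : EuclideanSpace ℝ (Fin 3) | ∀ i, c i - ((R : ℝ) + 1 / 2) * 1 < X i ∧ X i < c i + ((R : ℝ) + 1 / 2) * 1}
      = {X : EuclideanSpace ℝ (Fin 3) | ∀ i, (z i : ℝ) - R < X i ∧ X i < z i + R + 1} := by
    ext X; simp only [Set.mem_setOf_eq, hc, mul_one]
    constructor
    · intro h i; have := h i; constructor <;> linarith [this.1, this.2]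
    · intro h i; have := h i; constructor <;> linarith [this.1, this.2]
  refine ⟨?_, ?_, ?_⟩
  · intro x hx
    rw [hJ]
    refine norm_interp_le_one_on_bigBox φ hφ S u I hI (fun w => (hu w).le) z R hS fun i => ?_
    have h := hx i
    rw [abs_lt] at h
    simp only [PiLp.add_apply, PiLp.smul_apply, smul_eq_mul, hc]
    constructor <;> nlinarith [h.1, h.2, hR']
  · rw [hJeq, integral_cube_energyDensity_rescale I c hR' 1, hbox]
    exact mul_le_mul_of_nonneg_left (bondEnergy_le_integral_bigBox_le_bondEnergy φ hφ S u I hI z R hS).2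
      (inv_nonneg.mpr hR'.le)
  · -- change of variables for the (non-derivative) integrand `(‖I‖ - 1)²`
    have hcv : ∫ x in {x : EuclideanSpace ℝ (Fin 3) | ∀ i, |x i| < 1}, (‖J x‖ - 1) ^ 2 =
        (((R : ℝ) + 1 / 2) ^ 3)⁻¹ * ∫ X in {X : EuclideanSpace ℝ (Fin 3) | ∀ i, (z i : ℝ) - R < X i ∧ X i < z i + R + 1},
          (‖I X‖ - 1) ^ 2 := by
      rw [hJeq]
      have h1 := Measure.setIntegral_comp_smul_of_pos volume (fun y => (‖I (c + y)‖ - 1) ^ 2)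
        {x : EuclideanSpace ℝ (Fin 3) | ∀ i, |x i| < 1} hR'
      simp only [finrank_euclideanSpace_fin, smul_eq_mul] at h1
      rw [h1, smul_centredCube hR' 1]
      congr 1
      rw [← integral_indicator (measurableSet_centredCube _), ← hbox, ← integral_indicator (measurableSet_box c _ 1)]
      have hind : (fun y => Set.indicator {y : EuclideanSpace ℝ (Fin 3) | ∀ i, |y i| < ((R : ℝ) + 1 / 2) * 1}
          (fun y => (‖I (c + y)‖ - 1) ^ 2) y) =
          fun y => Set.indicator {X : EuclideanSpace ℝ (Fin 3) | ∀ i, c i - ((R : ℝ) + 1 / 2) * 1 < X i ∧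
            X i < c i + ((R : ℝ) + 1 / 2) * 1} (fun X => (‖I X‖ - 1) ^ 2) (c + y) := by
        funext y
        by_cases hy : y ∈ {y : EuclideanSpace ℝ (Fin 3) | ∀ i, |y i| < ((R : ℝ) + 1 / 2) * 1}
        · rw [Set.indicator_of_mem hy, Set.indicator_of_mem ((add_mem_box_iff c y _ 1).mpr hy)]
        · rw [Set.indicator_of_notMem hy, Set.indicator_of_notMem (fun h => hy ((add_mem_box_iff c y _ 1).mp h))]
      rw [hind]
      exact integral_add_left_eq_self (Set.indicator {X : EuclideanSpace ℝ (Fin 3) | ∀ i, c i - ((R : ℝ) + 1 / 2) * 1 < X i ∧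
            X i < c i + ((R : ℝ) + 1 / 2) * 1} (fun X => (‖I X‖ - 1) ^ 2)) c
    rw [hcv, mul_assoc]
    have h3 := integral_bigBox_sq_norm_sub_one_le φ hφ S u I hI hu z R hS
    have hpos : 0 ≤ (((R : ℝ) + 1 / 2) ^ 3)⁻¹ := by positivity
    calc (((R : ℝ) + 1 / 2) ^ 3)⁻¹ * ∫ X in {X : EuclideanSpace ℝ (Fin 3) | ∀ i, (z i : ℝ) - R < X i ∧ X i < z i + R + 1},
          (‖I X‖ - 1) ^ 2 ≤ (((R : ℝ) + 1 / 2) ^ 3)⁻¹ * (3 * ∑ w ∈ box z (R + 1), ∑ μ : Fin 3, ‖u (w + unitVec μ) - u w‖ ^ 2) :=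
          mul_le_mul_of_nonneg_left h3 hpos
      _ = _ := by ring

end Summit.QuantumFields.YangMills.Theorems.PoincareLipschitzKuhnBlowDown
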